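import Summits.AtomisticToContinuum.FouriersLaw.Theorems.BondHeatUncertaintyExtensiveSnapshotIrreversibilityEnergyWindowSkeletonDepartureIntegrabilityA

/-!
# Energy window, part W-5 — the four `L¹` conditions of the DEPARTURE identity for a bounded `C¹` — file 2 of 2 (sequel of `…BondHeatUncertaintyExtensiveSnapshotIrreversibilityEnergyWindowSkeletonDepartureIntegrabilityA`)

Split for the 400-line cap; the module docstring of file 1 describes the whole part.
This file holds §§4 & 6 (integrability along the Brownian path).
Same namespace, same section variables; no instance / notation / option; no proof holes.
[folklore]
-/

noncomputable section

namespace Summit.AtomisticToContinuum.FouriersLaw.Theorems.ExtensiveSnapshotIrreversibility.EnergyWindow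

open MeasureTheory ProbabilityTheory Filter Topology Set
open scoped ENNReal NNReal Matrix ContDiff
open Literature.MathematicalPhysics.KineticTheory.HeatConduction
open Literature.Probability.Process
open Literature.Probability.Distributions

-- PRIVATE copies (landing lane): these helpers are `private` in `BondHeatUncertaintyExtensiveSnapshotIrreversibilityEnergyWindowSkeletonArrivalIntegrability` (dedup gate), so each consumer module carries its own private copy.
/-- Young: `a b ≤ (a² + b²)/2`. [folklore] -/
private theorem mul_le_half_sq_add_sq (a b : ℝ) : a * b ≤ (a ^ 2 + b ^ 2) / 2 := by
  nlinarith [sq_nonneg (a - b)]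

/-! ## 4 & 6. Along the Brownian path: integrability -/

section Departure

variable {ω₂ lam β γ : ℝ} (hω : 0 < ω₂) (hl : 0 < lam) (hβ : 0 < β) (hγ : 0 < γ) {N : ℕ}
  (hN : 0 < N) {T T_L T_R : ℝ} (hT : 0 < T) (hTL : T / 2 ≤ T_L) (hTL' : T_L ≤ 2 * T)
  (hTR : T / 2 ≤ T_R) (hTR' : T_R ≤ 2 * T)

include hω hl hβ hγ in
/-- `∂_z E[v]` along the path is measurable. [folklore] -/
theorem measurable_fderiv_left_path {s : ℝ} (hs : s ∈ Icc (0 : ℝ) 1) (m : ℕ)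
    (z v : PhaseSpace N) :
    Measurable fun wp : WienerPair => fderiv ℝ
      (fun z' => skelFlowMapAt ω₂ lam β γ N T_L T_R s m z' (pairRem m wp) (pairSkel m wp)) z v := by
  have h := (measurable_fderiv_skelFlowMapAt_left_apply hω hl.le hβ.le hγ.le N T_L T_R hs m z
    v).comp (measurable_pairSkel_prodMk_pairRem m)
  exact h

include hω hl hβ hγ in
/-- `‖∂_z E[v]‖` along the path is measurable. [folklore] -/
theorem measurable_norm_fderiv_left_path {s : ℝ} (hs : s ∈ Icc (0 : ℝ) 1) (m : ℕ)
    (z v : PhaseSpace N) :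
    Measurable fun wp : WienerPair => ‖fderiv ℝ
      (fun z' => skelFlowMapAt ω₂ lam β γ N T_L T_R s m z' (pairRem m wp) (pairSkel m wp)) z v‖ :=
  (measurable_fderiv_left_path hω hl hβ hγ hs m z v).norm

include hω hl hβ hγ in
/-- `‖∂_δ ∂_z E[v]‖` along the path is measurable. [folklore] -/
theorem measurable_norm_fderiv_fderiv_mixed_path {s : ℝ} (hs : s ∈ Icc (0 : ℝ) 1) (m : ℕ)
    (z v : PhaseSpace N) (δ : PairSkeleton m) :
    Measurable fun wp : WienerPair => ‖fderiv ℝ (fun y => fderiv ℝ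
      (fun z' => skelFlowMapAt ω₂ lam β γ N T_L T_R s m z' (pairRem m wp) y) z v)
        (pairSkel m wp) δ‖ := by
  have h := (measurable_fderiv_fderiv_skelFlowMapAt_mixed_apply hω hl.le hβ.le hγ.le N T_L T_R hs
    m z v δ).comp (measurable_pairSkel_prodMk_pairRem m)
  exact h.norm

include hω hl hβ hγ hN hT hTL hTL' hTR hTR' in
/-- **`‖∂_z E[v]‖^n ∈ L¹(wienerPair)`** for every `n ≥ 1` (§2). [folklore] -/
theorem integrable_pow_norm_fderiv_left_path {s : ℝ} (hs : s ∈ Icc (0 : ℝ) 1) (m : ℕ)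
    (z v : PhaseSpace N) (n : ℕ) (hn : 1 ≤ n) :
    Integrable (fun wp : WienerPair => ‖fderiv ℝ
      (fun z' => skelFlowMapAt ω₂ lam β γ N T_L T_R s m z' (pairRem m wp) (pairSkel m wp)) z v‖ ^ n)
      wienerPair := by
  obtain ⟨C, hC⟩ := skeletonStartVariationMoments ω₂ lam β γ hω hl hβ hγ T hT N hN n 1
    (by exact_mod_cast hn) one_pos
  have hb := hC T_L T_R hTL hTL' hTR hTR' s hs.1 hs.2 m z v
  exact integrable_pow_of_lintegral_rpow_ne_top (measurable_norm_fderiv_left_path hω hl hβ hγ hs m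
    z v) (fun _ => norm_nonneg _) n (ne_top_of_le_ne_top ENNReal.ofReal_ne_top hb)

include hω hl hβ hγ hN hT hTL hTL' hTR hTR' in
/-- **`‖∂_δ ∂_z E[v]‖^n ∈ L¹(wienerPair)`** for every `n ≥ 1` (W-4 `skeletonMixedVariationMoments`).
[folklore] -/
theorem integrable_pow_norm_fderiv_fderiv_mixed_path {s : ℝ} (hs : s ∈ Icc (0 : ℝ) 1) (m : ℕ)
    (z v : PhaseSpace N) (δ : PairSkeleton m) (n : ℕ) (hn : 1 ≤ n) :
    Integrable (fun wp : WienerPair => ‖fderiv ℝ (fun y => fderiv ℝ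
      (fun z' => skelFlowMapAt ω₂ lam β γ N T_L T_R s m z' (pairRem m wp) y) z v)
        (pairSkel m wp) δ‖ ^ n) wienerPair := by
  obtain ⟨C, hC⟩ := skeletonMixedVariationMoments ω₂ lam β γ hω hl hβ hγ T hT N hN n 1
    (by exact_mod_cast hn) one_pos
  have hb := hC T_L T_R hTL hTL' hTR hTR' s hs.1 hs.2 m z v δ
  exact integrable_pow_of_lintegral_rpow_ne_top (measurable_norm_fderiv_fderiv_mixed_path hω hl
    hβ hγ hs m z v δ) (fun _ => norm_nonneg _) n (ne_top_of_le_ne_top ENNReal.ofReal_ne_top hb)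

include hω hl hβ hγ in
/-- The departure field along the path is measurable. [folklore] -/
theorem measurable_skelFieldDep_path {s : ℝ} (hs : s ∈ Icc (0 : ℝ) 1) (m : ℕ) (κ : ℝ) (b : Fin N)
    (z : PhaseSpace N) (j : Fin (2 ^ m) ⊕ Fin (2 ^ m)) :
    Measurable fun wp : WienerPair =>
      skelFieldDep ω₂ lam β γ N T_L T_R s m κ b z (pairRem m wp) (pairSkel m wp) j := by
  have h := (measurable_skelFieldDep_apply hω hl.le hβ.le hγ.le N T_L T_R hs m κ b z j).comp
    (measurable_pairSkel_prodMk_pairRem m)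
  exact h

include hω hl hβ hγ in
/-- The skeleton derivative of the departure field along the path is measurable. [folklore] -/
theorem measurable_fderiv_skelFieldDep_path {s : ℝ} (hs : s ∈ Icc (0 : ℝ) 1) (m : ℕ) {κ : ℝ}
    (hκ : 0 < κ) (b : Fin N) (z : PhaseSpace N) (j : Fin (2 ^ m) ⊕ Fin (2 ^ m))
    (v : PairSkeleton m) :
    Measurable fun wp : WienerPair => fderiv ℝ (fun y =>
      skelFieldDep ω₂ lam β γ N T_L T_R s m κ b z (pairRem m wp) y j) (pairSkel m wp) v := by
  have hF := measurable_skelFieldDep_apply hω hl.le hβ.le hγ.le N T_L T_R hs m κ b z j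
  have hd : ∀ (r : WienerPair) (x : PairSkeleton m), DifferentiableAt ℝ
      (fun y => skelFieldDep ω₂ lam β γ N T_L T_R s m κ b z r y j) x :=
    fun r x => (contDiff_skelFieldDep_apply hω hl.le hβ.le hγ.le N T_L T_R hs m hκ b z r
      j).differentiable (by simp) x
  have h := (measurable_fderiv_apply_of_param
    (fun p : PairSkeleton m × WienerPair => skelFieldDep ω₂ lam β γ N T_L T_R s m κ b z p.2 p.1 j)
    hF hd v).comp (measurable_pairSkel_prodMk_pairRem m)
  exact h

include hω hl hβ hγ in
/-- The regularised departure weight along the path is measurable. [folklore] -/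
theorem measurable_skelWeightDep_path {s : ℝ} (hs : s ∈ Icc (0 : ℝ) 1) (m : ℕ) {κ : ℝ}
    (hκ : 0 < κ) (b : Fin N) (z : PhaseSpace N) :
    Measurable fun wp : WienerPair =>
      skelWeightDep ω₂ lam β γ N T_L T_R s m κ b z (pairRem m wp) (pairSkel m wp) := by
  have h1 : ∀ j, Measurable fun wp : WienerPair => coordX m (pairSkel m wp) j *
      skelFieldDep ω₂ lam β γ N T_L T_R s m κ b z (pairRem m wp) (pairSkel m wp) j := fun j =>
    ((measurable_coordX m j).comp (measurable_pairSkel m)).mul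
      (measurable_skelFieldDep_path hω hl hβ hγ hs m κ b z j)
  have h2 : ∀ j, Measurable fun wp : WienerPair => fderiv ℝ (fun y =>
      skelFieldDep ω₂ lam β γ N T_L T_R s m κ b z (pairRem m wp) y j) (pairSkel m wp)
        (basisX m j) := fun j =>
    measurable_fderiv_skelFieldDep_path hω hl hβ hγ hs m hκ b z j (basisX m j)
  have h := (Finset.measurable_sum Finset.univ fun j _ => h1 j).sub
    ((Finset.measurable_sum Finset.univ fun j _ => h2 j).const_mul (((2 : ℝ) ^ m)⁻¹))
  exact h

include hω hl hβ hγ hN hT hTL hTL' hTR hTR' in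
/-- **hGu (departure)**: `g(E) u^dep_j ∈ L¹` for bounded continuously-differentiable `g`.
[folklore] -/
theorem integrable_mul_skelFieldDep {s : ℝ} (hs : s ∈ Icc (0 : ℝ) 1) (m : ℕ) {κ : ℝ}
    (hκ : 0 < κ) (b : Fin N) (z : PhaseSpace N) {g : PhaseSpace N → ℝ} (hg : ContDiff ℝ 1 g)
    {M₀ : ℝ} (hgM : ∀ w, |g w| ≤ M₀) (j : Fin (2 ^ m) ⊕ Fin (2 ^ m)) :
    Integrable (fun wp =>
      g (skelFlowMapAt ω₂ lam β γ N T_L T_R s m z (pairRem m wp) (pairSkel m wp)) *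
        skelFieldDep ω₂ lam β γ N T_L T_R s m κ b z (pairRem m wp) (pairSkel m wp) j) wienerPair := by
  have hM₀ : 0 ≤ M₀ := (abs_nonneg _).trans (hgM 0)
  set K : ℝ := (Fintype.card (Fin N ⊕ Fin N) : ℝ) with hK
  have hK0 : 0 ≤ K := Nat.cast_nonneg _
  have hκ0 : 0 ≤ κ⁻¹ := inv_nonneg.2 hκ.le
  have hF2 := integrable_pow_norm_fderiv_path hω hl hβ hγ hN hT hTL hTL' hTR hTR' hs m z
    (basisX m j) 2 one_le_two
  have hZ2 := integrable_pow_norm_fderiv_left_path hω hl hβ hγ hN hT hTL hTL' hTR hTR' hs m z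
    ((0 : Fin N → ℝ), Pi.single b 1) 2 one_le_two
  refine Integrable.mono' (((hZ2.add hF2).div_const 2).const_mul (M₀ * (K * (κ⁻¹ * K))))
    ((measurable_comp_skelFlowMapAt_path hω hl hβ hγ s m z hg.continuous).mul
      (measurable_skelFieldDep_path hω hl hβ hγ hs m κ b z j)).aestronglyMeasurable
    (Eventually.of_forall fun wp => ?_)
  rw [Real.norm_eq_abs, abs_mul]
  have hu := abs_skelFieldDep_le (ω₂ := ω₂) (lam := lam) (β := β) (γ := γ) N T_L T_R s m hκ b z
    (pairRem m wp) (pairSkel m wp) j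
  rw [← hK] at hu
  set Z := ‖fderiv ℝ (fun z' => skelFlowMapAt ω₂ lam β γ N T_L T_R s m z' (pairRem m wp)
    (pairSkel m wp)) z ((0 : Fin N → ℝ), Pi.single b 1)‖ with hZdef
  set F := ‖fderiv ℝ (skelFlowMapAt ω₂ lam β γ N T_L T_R s m z (pairRem m wp)) (pairSkel m wp)
    (basisX m j)‖ with hFdef
  have hy : Z * F ≤ (Z ^ 2 + F ^ 2) / 2 := mul_le_half_sq_add_sq Z F
  calc |g (skelFlowMapAt ω₂ lam β γ N T_L T_R s m z (pairRem m wp) (pairSkel m wp))| *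
        |skelFieldDep ω₂ lam β γ N T_L T_R s m κ b z (pairRem m wp) (pairSkel m wp) j|
      ≤ M₀ * (K * (κ⁻¹ * (K * Z)) * F) := mul_le_mul (hgM _) hu (abs_nonneg _) hM₀
    _ = M₀ * (K * (κ⁻¹ * K)) * (Z * F) := by ring
    _ ≤ M₀ * (K * (κ⁻¹ * K)) * ((Z ^ 2 + F ^ 2) / 2) := mul_le_mul_of_nonneg_left hy (by positivity)
    _ = _ := by rw [hZdef, hFdef]; simp only [Pi.add_apply]

include hω hl hβ hγ hN hT hTL hTL' hTR hTR' in
/-- **hxGu (departure)**: `x_j g(E) u^dep_j ∈ L¹`. [folklore] -/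
theorem integrable_coordX_mul_mul_skelFieldDep {s : ℝ} (hs : s ∈ Icc (0 : ℝ) 1) (m : ℕ) {κ : ℝ}
    (hκ : 0 < κ) (b : Fin N) (z : PhaseSpace N) {g : PhaseSpace N → ℝ} (hg : ContDiff ℝ 1 g)
    {M₀ : ℝ} (hgM : ∀ w, |g w| ≤ M₀) (j : Fin (2 ^ m) ⊕ Fin (2 ^ m)) :
    Integrable (fun wp => coordX m (pairSkel m wp) j *
      (g (skelFlowMapAt ω₂ lam β γ N T_L T_R s m z (pairRem m wp) (pairSkel m wp)) *
        skelFieldDep ω₂ lam β γ N T_L T_R s m κ b z (pairRem m wp) (pairSkel m wp) j))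
      wienerPair := by
  have hM₀ : 0 ≤ M₀ := (abs_nonneg _).trans (hgM 0)
  set K : ℝ := (Fintype.card (Fin N ⊕ Fin N) : ℝ) with hK
  have hK0 : 0 ≤ K := Nat.cast_nonneg _
  have hκ0 : 0 ≤ κ⁻¹ := inv_nonneg.2 hκ.le
  have hF4 := integrable_pow_norm_fderiv_path hω hl hβ hγ hN hT hTL hTL' hTR hTR' hs m z
    (basisX m j) 4 (by norm_num)
  have hZ4 := integrable_pow_norm_fderiv_left_path hω hl hβ hγ hN hT hTL hTL' hTR hTR' hs m z
    ((0 : Fin N → ℝ), Pi.single b 1) 4 (by norm_num)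
  have hX2 := integrable_sq_coordX_pairSkel m j
  refine Integrable.mono'
    (((hX2.add ((hZ4.add hF4).div_const 2)).div_const 2).const_mul (M₀ * (K * (κ⁻¹ * K))))
    (((measurable_coordX m j).comp (measurable_pairSkel m)).mul
      ((measurable_comp_skelFlowMapAt_path hω hl hβ hγ s m z hg.continuous).mul
        (measurable_skelFieldDep_path hω hl hβ hγ hs m κ b z j))).aestronglyMeasurable
    (Eventually.of_forall fun wp => ?_)
  rw [Real.norm_eq_abs, abs_mul, abs_mul]
  have hu := abs_skelFieldDep_le (ω₂ := ω₂) (lam := lam) (β := β) (γ := γ) N T_L T_R s m hκ b z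
    (pairRem m wp) (pairSkel m wp) j
  rw [← hK] at hu
  set Z := ‖fderiv ℝ (fun z' => skelFlowMapAt ω₂ lam β γ N T_L T_R s m z' (pairRem m wp)
    (pairSkel m wp)) z ((0 : Fin N → ℝ), Pi.single b 1)‖ with hZdef
  set F := ‖fderiv ℝ (skelFlowMapAt ω₂ lam β γ N T_L T_R s m z (pairRem m wp)) (pairSkel m wp)
    (basisX m j)‖ with hFdef
  set X := coordX m (pairSkel m wp) j with hXdef
  have hy : |X| * (Z * F) ≤ (X ^ 2 + (Z ^ 4 + F ^ 4) / 2) / 2 := by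
    have h1 : |X| * (Z * F) ≤ (|X| ^ 2 + (Z * F) ^ 2) / 2 := mul_le_half_sq_add_sq |X| (Z * F)
    have h2 : (Z * F) ^ 2 ≤ (Z ^ 4 + F ^ 4) / 2 := by nlinarith [sq_nonneg (Z ^ 2 - F ^ 2)]
    rw [sq_abs] at h1
    linarith
  calc |X| * (|g (skelFlowMapAt ω₂ lam β γ N T_L T_R s m z (pairRem m wp) (pairSkel m wp))| *
        |skelFieldDep ω₂ lam β γ N T_L T_R s m κ b z (pairRem m wp) (pairSkel m wp) j|)
      ≤ |X| * (M₀ * (K * (κ⁻¹ * (K * Z)) * F)) :=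
        mul_le_mul_of_nonneg_left (mul_le_mul (hgM _) hu (abs_nonneg _) hM₀) (abs_nonneg _)
    _ = M₀ * (K * (κ⁻¹ * K)) * (|X| * (Z * F)) := by ring
    _ ≤ M₀ * (K * (κ⁻¹ * K)) * ((X ^ 2 + (Z ^ 4 + F ^ 4) / 2) / 2) :=
        mul_le_mul_of_nonneg_left hy (by positivity)
    _ = _ := by rw [hXdef, hZdef, hFdef]; simp only [Pi.add_apply]

include hω hl hβ hγ hN hT hTL hTL' hTR hTR' in
/-- **hdGu (departure)**: `∂_j(g∘E) u^dep_j ∈ L¹` for `g ∈ C¹` with `|Dg(w)v| ≤ L‖v‖`. [folklore] -/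
theorem integrable_fderiv_comp_mul_skelFieldDep {s : ℝ} (hs : s ∈ Icc (0 : ℝ) 1) (m : ℕ) {κ : ℝ}
    (hκ : 0 < κ) (b : Fin N) (z : PhaseSpace N) {g : PhaseSpace N → ℝ} (hg : ContDiff ℝ 1 g)
    {L : ℝ} (hgL : ∀ w v, |fderiv ℝ g w v| ≤ L * ‖v‖) (j : Fin (2 ^ m) ⊕ Fin (2 ^ m)) :
    Integrable (fun wp =>
      fderiv ℝ (fun y => g (skelFlowMapAt ω₂ lam β γ N T_L T_R s m z (pairRem m wp) y))
          (pairSkel m wp) (basisX m j) *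
        skelFieldDep ω₂ lam β γ N T_L T_R s m κ b z (pairRem m wp) (pairSkel m wp) j) wienerPair := by
  have hL : 0 ≤ L := by
    have h := hgL 0 ((0 : Fin N → ℝ), Pi.single (⟨0, hN⟩ : Fin N) 1)
    have hn : (0 : ℝ) < ‖(((0 : Fin N → ℝ), Pi.single (⟨0, hN⟩ : Fin N) (1 : ℝ)) : PhaseSpace N)‖ := by
      refine norm_pos_iff.2 fun h0 => ?_
      have h1 := congrArg (fun w : PhaseSpace N => w.2 ⟨0, hN⟩) h0
      simp at h1
    exact nonneg_of_mul_nonneg_left ((abs_nonneg _).trans h) hn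
  set K : ℝ := (Fintype.card (Fin N ⊕ Fin N) : ℝ) with hK
  have hK0 : 0 ≤ K := Nat.cast_nonneg _
  have hκ0 : 0 ≤ κ⁻¹ := inv_nonneg.2 hκ.le
  have hF4 := integrable_pow_norm_fderiv_path hω hl hβ hγ hN hT hTL hTL' hTR hTR' hs m z
    (basisX m j) 4 (by norm_num)
  have hZ2 := integrable_pow_norm_fderiv_left_path hω hl hβ hγ hN hT hTL hTL' hTR hTR' hs m z
    ((0 : Fin N → ℝ), Pi.single b 1) 2 one_le_two
  refine Integrable.mono' (((hZ2.add hF4).div_const 2).const_mul (L * (K * (κ⁻¹ * K))))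
    ((measurable_fderiv_comp_skelFlowMapAt_path hω hl hβ hγ hs m z hg (basisX m j)).mul
      (measurable_skelFieldDep_path hω hl hβ hγ hs m κ b z j)).aestronglyMeasurable
    (Eventually.of_forall fun wp => ?_)
  rw [Real.norm_eq_abs, abs_mul,
    fderiv_comp_skelFlowMapAt_apply hω hl.le hβ.le hγ.le N T_L T_R hs m z (pairRem m wp)
      (pairSkel m wp) ((hg.differentiable one_ne_zero) _) (basisX m j)]
  have hu := abs_skelFieldDep_le (ω₂ := ω₂) (lam := lam) (β := β) (γ := γ) N T_L T_R s m hκ b z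
    (pairRem m wp) (pairSkel m wp) j
  rw [← hK] at hu
  have hg1 := hgL (skelFlowMapAt ω₂ lam β γ N T_L T_R s m z (pairRem m wp) (pairSkel m wp))
    (fderiv ℝ (skelFlowMapAt ω₂ lam β γ N T_L T_R s m z (pairRem m wp)) (pairSkel m wp)
      (basisX m j))
  set Z := ‖fderiv ℝ (fun z' => skelFlowMapAt ω₂ lam β γ N T_L T_R s m z' (pairRem m wp)
    (pairSkel m wp)) z ((0 : Fin N → ℝ), Pi.single b 1)‖ with hZdef
  set F := ‖fderiv ℝ (skelFlowMapAt ω₂ lam β γ N T_L T_R s m z (pairRem m wp)) (pairSkel m wp)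
    (basisX m j)‖ with hFdef
  have hy : Z * F ^ 2 ≤ (Z ^ 2 + F ^ 4) / 2 := mul_sq_le_half_sq_add_pow_four Z F
  calc _ ≤ L * F * (K * (κ⁻¹ * (K * Z)) * F) := mul_le_mul hg1 hu (abs_nonneg _) ((abs_nonneg _).trans hg1)
    _ = L * (K * (κ⁻¹ * K)) * (Z * F ^ 2) := by ring
    _ ≤ L * (K * (κ⁻¹ * K)) * ((Z ^ 2 + F ^ 4) / 2) := mul_le_mul_of_nonneg_left hy (by positivity)
    _ = _ := by rw [hZdef, hFdef]; simp only [Pi.add_apply]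

include hω hl hβ hγ hN hT hTL hTL' hTR hTR' in
/-- **hGdu (departure)**: `g(E) ∂_j u^dep_j ∈ L¹` for bounded `g ∈ C¹`, from (JMᶻ)/(JMˣ)₁/(JMˣ)₂
and the mixed variation (W-4) via §5's bound on `∂_j u^dep_j`. [folklore] -/
theorem integrable_mul_fderiv_skelFieldDep {s : ℝ} (hs : s ∈ Icc (0 : ℝ) 1) (m : ℕ) {κ : ℝ}
    (hκ : 0 < κ) (b : Fin N) (z : PhaseSpace N) {g : PhaseSpace N → ℝ} (hg : ContDiff ℝ 1 g)
    {M₀ : ℝ} (hgM : ∀ w, |g w| ≤ M₀) (j : Fin (2 ^ m) ⊕ Fin (2 ^ m)) :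
    Integrable (fun wp =>
      g (skelFlowMapAt ω₂ lam β γ N T_L T_R s m z (pairRem m wp) (pairSkel m wp)) *
        fderiv ℝ (fun y => skelFieldDep ω₂ lam β γ N T_L T_R s m κ b z (pairRem m wp) y j)
          (pairSkel m wp) (basisX m j)) wienerPair := by
  have hM₀ : 0 ≤ M₀ := (abs_nonneg _).trans (hgM 0)
  -- the random quantities along the path
  set F : (Fin (2 ^ m) ⊕ Fin (2 ^ m)) → WienerPair → ℝ := fun l wp =>
    ‖fderiv ℝ (skelFlowMapAt ω₂ lam β γ N T_L T_R s m z (pairRem m wp)) (pairSkel m wp)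
      (basisX m l)‖ with hFdef
  set S : (Fin (2 ^ m) ⊕ Fin (2 ^ m)) → WienerPair → ℝ := fun l wp =>
    ‖fderiv ℝ (fun y => fderiv ℝ (skelFlowMapAt ω₂ lam β γ N T_L T_R s m z (pairRem m wp)) y
      (basisX m l)) (pairSkel m wp) (basisX m j)‖ with hSdef
  set Z : WienerPair → ℝ := fun wp =>
    ‖fderiv ℝ (fun z' => skelFlowMapAt ω₂ lam β γ N T_L T_R s m z' (pairRem m wp) (pairSkel m wp))
      z ((0 : Fin N → ℝ), Pi.single b 1)‖ with hZdef
  set Mx : WienerPair → ℝ := fun wp =>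
    ‖fderiv ℝ (fun y => fderiv ℝ (fun z' => skelFlowMapAt ω₂ lam β γ N T_L T_R s m z'
      (pairRem m wp) y) z ((0 : Fin N → ℝ), Pi.single b 1)) (pairSkel m wp) (basisX m j)‖
    with hMxdef
  have hFi : ∀ l (n : ℕ), 1 ≤ n → Integrable (fun wp => F l wp ^ n) wienerPair := fun l n hn =>
    integrable_pow_norm_fderiv_path hω hl hβ hγ hN hT hTL hTL' hTR hTR' hs m z (basisX m l) n hn
  have hSi : ∀ l (n : ℕ), 1 ≤ n → Integrable (fun wp => S l wp ^ n) wienerPair := fun l n hn =>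
    integrable_pow_norm_fderiv_fderiv_path hω hl hβ hγ hN hT hTL hTL' hTR hTR'
      skeletonSecondVariationMoments hs m z (basisX m l) (basisX m j) n hn
  have hZi : ∀ n : ℕ, 1 ≤ n → Integrable (fun wp => Z wp ^ n) wienerPair := fun n hn =>
    integrable_pow_norm_fderiv_left_path hω hl hβ hγ hN hT hTL hTL' hTR hTR' hs m z _ n hn
  have hMi : ∀ n : ℕ, 1 ≤ n → Integrable (fun wp => Mx wp ^ n) wienerPair := fun n hn =>
    integrable_pow_norm_fderiv_fderiv_mixed_path hω hl hβ hγ hN hT hTL hTL' hTR hTR' hs m z _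
      (basisX m j) n hn
  -- constants
  set K : ℝ := (Fintype.card (Fin N ⊕ Fin N) : ℝ) with hK
  have hK0 : 0 ≤ K := Nat.cast_nonneg _
  have hκ0 : 0 ≤ κ⁻¹ := inv_nonneg.2 hκ.le
  set c : ℝ := ((2 : ℝ) ^ m)⁻¹ with hc
  have hc0 : 0 ≤ c := by positivity
  -- the Young dominator
  have hD'i : Integrable (fun wp => M₀ * (K * (κ⁻¹ * K * ((Z wp ^ 2 + S j wp ^ 2) / 2) +
      κ⁻¹ * K * ((F j wp ^ 2 + Mx wp ^ 2) / 2) +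
      κ⁻¹ * κ⁻¹ * K * K ^ 2 * 2 * c *
        ∑ l, (((F j wp ^ 4 + Z wp ^ 4) / 2 + (F l wp ^ 4 + S l wp ^ 4) / 2) / 2)))) wienerPair := by
    have h1 : Integrable (fun wp => (Z wp ^ 2 + S j wp ^ 2) / 2) wienerPair :=
      ((hZi 2 one_le_two).add (hSi j 2 one_le_two)).div_const 2
    have h2 : Integrable (fun wp => (F j wp ^ 2 + Mx wp ^ 2) / 2) wienerPair :=
      ((hFi j 2 one_le_two).add (hMi 2 one_le_two)).div_const 2
    have h3 : Integrable (fun wp =>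
        ∑ l, (((F j wp ^ 4 + Z wp ^ 4) / 2 + (F l wp ^ 4 + S l wp ^ 4) / 2) / 2)) wienerPair :=
      integrable_finsetSum _ fun l _ =>
        ((((hFi j 4 (by norm_num)).add (hZi 4 (by norm_num))).div_const 2).add
          (((hFi l 4 (by norm_num)).add (hSi l 4 (by norm_num))).div_const 2)).div_const 2
    exact (((h1.const_mul (κ⁻¹ * K)).add (h2.const_mul (κ⁻¹ * K))).add
      (h3.const_mul (κ⁻¹ * κ⁻¹ * K * K ^ 2 * 2 * c))).const_mul K |>.const_mul M₀
  refine Integrable.mono' hD'i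
    ((measurable_comp_skelFlowMapAt_path hω hl hβ hγ s m z hg.continuous).mul
      (measurable_fderiv_skelFieldDep_path hω hl hβ hγ hs m hκ b z j (basisX m j))).aestronglyMeasurable
    (Eventually.of_forall fun wp => ?_)
  rw [Real.norm_eq_abs, abs_mul]
  have hdu := abs_fderiv_skelFieldDep_le hω hl.le hβ.le hγ.le N T_L T_R hs m hκ b z (pairRem m wp)
    (pairSkel m wp) (basisX m j) j
  rw [← hK] at hdu
  -- rearrangement of W-1's bound
  have hDeq : K * ((κ⁻¹ * (K * Z wp)) * S j wp + F j wp * (κ⁻¹ * (K * Mx wp +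
      (κ⁻¹ * (K * Z wp)) * (K ^ 2 * (2 * (c * ∑ l, F l wp * S l wp)))))) =
      K * (κ⁻¹ * K * (Z wp * S j wp) + κ⁻¹ * K * (F j wp * Mx wp) +
        κ⁻¹ * κ⁻¹ * K * K ^ 2 * 2 * c * (F j wp * Z wp * ∑ l, F l wp * S l wp)) := by ring
  -- Young on each product
  have hy1 : Z wp * S j wp ≤ (Z wp ^ 2 + S j wp ^ 2) / 2 := mul_le_half_sq_add_sq _ _
  have hy2 : F j wp * Mx wp ≤ (F j wp ^ 2 + Mx wp ^ 2) / 2 := mul_le_half_sq_add_sq _ _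
  have hy3 : F j wp * Z wp * ∑ l, F l wp * S l wp ≤
      ∑ l, (((F j wp ^ 4 + Z wp ^ 4) / 2 + (F l wp ^ 4 + S l wp ^ 4) / 2) / 2) := by
    rw [Finset.mul_sum]
    exact Finset.sum_le_sum fun l _ => mul_mul_mul_le_young4 _ _ _ _
  have hD : K * ((κ⁻¹ * (K * Z wp)) * S j wp + F j wp * (κ⁻¹ * (K * Mx wp +
      (κ⁻¹ * (K * Z wp)) * (K ^ 2 * (2 * (c * ∑ l, F l wp * S l wp)))))) ≤
      K * (κ⁻¹ * K * ((Z wp ^ 2 + S j wp ^ 2) / 2) + κ⁻¹ * K * ((F j wp ^ 2 + Mx wp ^ 2) / 2) +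
        κ⁻¹ * κ⁻¹ * K * K ^ 2 * 2 * c *
          ∑ l, (((F j wp ^ 4 + Z wp ^ 4) / 2 + (F l wp ^ 4 + S l wp ^ 4) / 2) / 2)) := by
    rw [hDeq]
    refine mul_le_mul_of_nonneg_left (add_le_add (add_le_add
      (mul_le_mul_of_nonneg_left hy1 (mul_nonneg hκ0 hK0))
      (mul_le_mul_of_nonneg_left hy2 (mul_nonneg hκ0 hK0)))
      (mul_le_mul_of_nonneg_left hy3 (by positivity))) hK0
  exact mul_le_mul (hgM _) (hdu.trans hD) (abs_nonneg _) hM₀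

end Departure

end Summit.AtomisticToContinuum.FouriersLaw.Theorems.ExtensiveSnapshotIrreversibility.EnergyWindow

end
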